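import Mathlib
import HarnessLib
import Summits.NavierStokesRegularity.NavierStokesRegularity.Theses.PoloidalWindowDoor
import Summits.NavierStokesRegularity.NavierStokesRegularity.Theorems.PoloidalWindowDoorPoloidalWindowRigiditySharper
import Summits.NavierStokesRegularity.NavierStokesRegularity.Theorems.PoloidalWindowDoorPoloidalWindowRigidityK2OfLrcSpatial
import Summits.NavierStokesRegularity.NavierStokesRegularity.Theorems.PoloidalWindowDoorPoloidalWindowRigidityHorizontalFlatPast
import Summits.NavierStokesRegularity.NavierStokesRegularity.Theorems.PoloidalWindowDoorPoloidalWindowRigidityTimeShearLiminf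
import Summits.NavierStokesRegularity.NavierStokesRegularity.Theorems.PoloidalWindowDoorPoloidalWindowRigidityStubUntwisted
import Summits.NavierStokesRegularity.NavierStokesRegularity.Theorems.PoloidalWindowDoorPoloidalWindowRigidityThmAThreeStubs
import Summits.NavierStokesRegularity.NavierStokesRegularity.Theorems.PoloidalWindowDoorPoloidalWindowRigidityThmARelocation
import Summits.NavierStokesRegularity.NavierStokesRegularity.Theorems.PoloidalWindowDoorPoloidalWindowRigidityStubExpTypeTH

/-!
# Crux K2 `PoloidalWindowRigidity` — line `entire_slices` (ns-idea-8 g0, lens «barrier», N0 THICK + (TH) columns)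

**v3 (2026-08-29, ns-es-p1 g7 — by-name wiring only, no statement changed):** the rung `stub_expTypeTH` is no longer a
`sorry` — it is DISCHARGED BY NAME from the landed Theorems helper
`…Theorems.PoloidalWindowDoorPoloidalWindowRigidityStubExpTypeTH.stub_expTypeTH` (p609463, ns-es-p1 g2; statement = the registered
rung binder for binder; proof route: band-limited lines ⇒ sub-parabolic gradient ⇒ apex regular, files …SubparabolicGradient /
…LinePairing / …LineBandLimited, all ACCEPTED `--supports stmt-NavierStokesRegularity-19708`).  `lean check`: sorries 3 = exactly the
three load-bearing stubs S\* `stub_horizontalEntire`, `stub_entireTH`, `stub_entireThick` (all OPEN; nothing else changed from v2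
5f8adea3609f / tree 4dcca062e28c).

**NS regularity is NOT proved by this file.**  It is a registered skeleton LINE for ONE crux
(`Summit.NavierStokesRegularity.NavierStokesRegularity.Theses.PoloidalWindowDoor.PoloidalWindowRigidity`, item
stmt-NavierStokesRegularity-19708): three `sorry`-stubs and a kernel-checked composition concluding the crux BY NAME.

## The line in one paragraph (barrier inversion at CLASS level)

Every class killed so far on the twisting residue of K2 is a statement about REAL JETS at one point (polynomial sector,
Theorems P/E/Q of `POLY-SECTOR-K2p5.md`; the jet strata (A)/(A′) of `STRATUM-A-K2p4.md`; the symmetric ansätze of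
`THICK-NF-K2p5.md`), about FINITE horizontal spectra (exp-polynomial sector, Theorem E: the exposed frequency `2ξ*` of the
quadratic term cannot be balanced — the catalogued frequency doubling `Literature/Barriers/NavierStokesRegularity/
BandLimitedFrequencyDoubling.lean`), or a real integral identity (census T1–T14).  The precisely typed statement JUST OUTSIDE all
of them is about the COMPLEX HORIZONTAL TYPE of the slices of a class profile: bounded + real-analytic on WHOLE planes, a slice
`x_h ↦ v(s, x_h, x₂)` is holomorphic on a horizontal strip; the line asserts (S*) that on a twisting non-degenerate pinned window it
is in fact ENTIRE in `x_h` (`stub_horizontalEntire`, stated in real terms: the Taylor coefficients at the points of a sub-window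
decay faster than every geometric rate), and that entire slices are impossible on the two open strata (`stub_entireTH`: the
hyperbolic time–height stratum; `stub_entireThick`: the thick stratum).  Why (S*) is the natural conjecture: the pins say exactly
`Λ ∉ {0,1}`, i.e. the complex characteristic varieties of the kinematic operator (`σ_z² + Λ σ_h²`) and of the class dynamics
(`(1−Λ)`-weighted heat symbol, null cone `σ_h² + σ_z² = 0`) are TRANSVERSAL, so by Zerner–Tsuno continuation across
non-characteristic hypersurfaces a bounded-type complex singularity of a slice can only lie on a null vertical plane
`{x ± iy = ζ₀}` — and every such plane meets `ℝ³`, where the slice is analytic; blow-up-type singularities are governed by an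
ARS/Painlevé balance (leading exponent `a = 2`, the self-advection cancels at top order) whose resonance conditions are a finite
exact computation = the instrument row that refutes or supports (S*).  Why the closing stubs are easier than the crux: for ENTIRE
slices the Fourier–Borel side exists — exponential type ⇔ compact horizontal spectrum (Paley–Wiener–Schwartz / Bernstein), whose
convex hull doubles under the quadratic term (Lions' support theorem) while every linear term of the class momentum equation
preserves it, reproducing Theorem E's `[E]_{2ξ*} = −(μ_z/2)Y² ≠ 0` for CONTINUOUS compact spectra on (TH), and giving on the thick
stratum the new exposed-mode identity `(U/W)_z = 0` (the top of the spectrum is (TV) — Theorem Q's rigid top, at class level);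
infinite type is attacked by the growth-indicator version of the same doubling (Wiman–Valiron).

Composition: `stub_horizontalEntire` + `stub_entireTH` + `stub_entireThick` ⇒ the three per-profile hypotheses `hH`, `hHT`,
`hST` of the TREE theorem `…ThmAThreeStubs.twisting_regular_of_three` (K2-p2's relocation, sorry-free) ⇒ the statement of
`lrc_jet`'s `stub_twisting` ⇒ (`mixed_type` v2's chain, copied: `…StubUntwisted.stub_untwisted`, `…K2OfLrcSpatial`,
`…TimeShearLiminf`, `…HorizontalFlatPast`, `…Sharper`) ⇒ `PoloidalWindowRigidity_of_entireSlices : …PoloidalWindowRigidity`.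
`lean check`: sorries ONLY in the three `stub_*`.

Disproof used: every stub keeps the class binders VERBATIM, in particular the Oseen identity (M) and the Type-I rate — it is not an
instance of `poloidalWindowRigidity_false_without_mild`, `twistingTH_false_without_mild` (K-47: the two-mode Kelvin `twistProfile`
is band-limited, hence satisfies the entire-type hypothesis of `stub_entireTH` — so (M) is load-bearing there: the doubling identity
IS the momentum equation), `hyperbolicThick_false_without_mild`, `semiEllipticThick_false_without_mild`,
`LocalTHEmpty[NUG]FalseWithoutSlopeGradient` (the pins and the twist are kept), nor of the LogTwistGerm `*_false_without_momentum`
lemmas.  Card: `Lines/entire_slices.md`.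
-/

set_option linter.dupNamespace false
set_option linter.unusedVariables false

namespace Summit.NavierStokesRegularity.NavierStokesRegularity.Cruxes.PoloidalWindowRigidity.EntireSlices

open Set Function Metric
open scoped RealInnerProductSpace InnerProductSpace Topology
open Literature.Analysis Literature.Analysis.FluidPDE
open Summit.NavierStokesRegularity.NavierStokesRegularity.Theorems.PoloidalWindowDoorPoloidalWindowRigiditySharper
open Summit.NavierStokesRegularity.NavierStokesRegularity.Theorems.PoloidalWindowDoorPoloidalWindowRigidityK2OfLrcSpatial
open Summit.NavierStokesRegularity.NavierStokesRegularity.Theorems.PoloidalWindowDoorPoloidalWindowRigidityHorizontalFlatPast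
open Summit.NavierStokesRegularity.NavierStokesRegularity.Theorems.PoloidalWindowDoorPoloidalWindowRigidityThmAThreeStubs
open Summit.NavierStokesRegularity.NavierStokesRegularity.Theorems.PoloidalWindowDoorPoloidalWindowRigidityThmARelocation

/-! ### The three registered stubs -/

/-- **STUB S\* (`stub_horizontalEntire`, the NEW statement of the line): a TWISTING non-degenerate pinned window of a
poloidal class profile contains a sub-window at whose points the horizontal-plane restrictions of the slice,
`p ↦ v(s, y + (p₀, p₁, 0))`, are (restrictions of) ENTIRE functions of the two horizontal variables, locally uniformly:
for every radius `R` one constant `A` bounds `‖D^n_h v(s,·)(y)‖ ≤ A·n!/R^n` for all orders `n` and all `(s,y)` in the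
sub-window** (real-variable phrasing of «infinite horizontal radius of convergence»; with the a-priori bounds of the class the
conclusion is equivalent to: each slice continues holomorphically in `x_h` to all of `ℂ²`).  Why plausible: pins ⇔ `Λ ∉ {0,1}` ⇔
transversal complex characteristics of the kinematic and the dynamic operator (Zerner–Tsuno: bounded-type singular hypersurfaces are
null vertical planes, all of which meet the real domain); blow-up type ⇒ ARS balance `a = 2` with resonance obstructions (instrument).
Why it might fail: an essential / accumulating complex singularity of a slice escapes both the Zerner–Tsuno and the Painlevé
analysis; the thick stratum's structure function `G(t,z,w)` is uncontrolled as `|w| → ∞` along complex paths. -/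
theorem stub_horizontalEntire :
    ∀ (C : ℝ) (v : ℝ → EuclideanSpace ℝ (Fin 3) → EuclideanSpace ℝ (Fin 3)),
      Literature.Analysis.FluidPDE.HasTypeITimeDecay C v →
      ContinuousOn (Function.uncurry v) (Set.Iio (0 : ℝ) ×ˢ Set.univ) →
      (∀ s t : ℝ, s < t → t < 0 → ∀ x, v t x =
        Literature.Analysis.UnboundedOperators.heatExtension (v s) (t - s) x -
          Literature.Analysis.FluidPDE.oseenDuhamel 1 s v v t x) →
      (∀ t < 0, Literature.Analysis.FluidPDE.VectorCalculus.IsDivFree (v t)) →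
      (∀ s < 0, ∀ y, ⟪Literature.Analysis.FluidPDE.curl (v s) y, EuclideanSpace.single 2 1⟫_ℝ = 0) →
      ∀ W : Set (ℝ × EuclideanSpace ℝ (Fin 3)), IsOpen W → W.Nonempty → W ⊆ Set.Iio (0 : ℝ) ×ˢ Set.univ →
        (∀ z ∈ W, Literature.Analysis.FluidPDE.curl (v z.1) z.2 ≠ 0 ∧
          (fderiv ℝ (v z.1) z.2 (EuclideanSpace.single 0 1) 2 ≠ 0 ∨ fderiv ℝ (v z.1) z.2 (EuclideanSpace.single 1 1) 2 ≠ 0) ∧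
          (fderiv ℝ (v z.1) z.2 (EuclideanSpace.single 2 1) 0 ≠ 0 ∨ fderiv ℝ (v z.1) z.2 (EuclideanSpace.single 2 1) 1 ≠ 0)) →
        (∀ m : ℝ → ℝ, ∀ W₁ : Set (ℝ × EuclideanSpace ℝ (Fin 3)), W₁ ⊆ W → IsOpen W₁ → W₁.Nonempty →
          ∃ z ∈ W₁, ∃ b : Fin 3, b ≠ 2 ∧
            fderiv ℝ (v z.1) z.2 (EuclideanSpace.single 2 1) b ≠
              m z.1 * fderiv ℝ (v z.1) z.2 (EuclideanSpace.single b 1) 2) →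
        (∀ z ∈ W,
          fderiv ℝ (fun x => fderiv ℝ (v z.1) x (EuclideanSpace.single 2 1) 2) z.2 (EuclideanSpace.single 0 1) *
              fderiv ℝ (v z.1) z.2 (EuclideanSpace.single 1 1) 2 -
            fderiv ℝ (fun x => fderiv ℝ (v z.1) x (EuclideanSpace.single 2 1) 2) z.2 (EuclideanSpace.single 1 1) *
              fderiv ℝ (v z.1) z.2 (EuclideanSpace.single 0 1) 2 ≠ 0) →
        ∃ W₁ : Set (ℝ × EuclideanSpace ℝ (Fin 3)), W₁ ⊆ W ∧ IsOpen W₁ ∧ W₁.Nonempty ∧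
          ∀ R : ℝ, 0 < R → ∃ A : ℝ, ∀ z ∈ W₁, ∀ n : ℕ,
            ‖iteratedFDeriv ℝ n (fun p : EuclideanSpace ℝ (Fin 2) =>
                v z.1 (z.2 + (EuclideanSpace.single 0 (p 0) + EuclideanSpace.single 1 (p 1)))) 0‖ ≤
              A * (Nat.factorial n : ℝ) / R ^ n := by
  sorry

/-- **STUB (`stub_entireTH`): on the HYPERBOLIC TIME–HEIGHT stratum, a twisting non-degenerate pinned window with ENTIRE
horizontal slices is impossible for a singular profile** — VERBATIM the binders of `mixed_type`'s registered `stub_hyperbolicTH`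
(class, poloidal, window, ND pins, (TV)-pin, twist, hyperbolicity `⟪∂₂vₕ,∇ₕv₂⟫ < 0`, slope law `∂₂v_b = m(t,x₂)∂_bv₂`), PLUS the
entire-type bound of S\* on the window, ⇒ `¬ IsBackwardSingularPoint v 0`.  The rung of the line: exponential type ⇒ compact
horizontal spectrum (Paley–Wiener–Schwartz) ⇒ exposed frequency `ξ*` of the convex hull; the class momentum equation (E) of the (TH)
normal form is linear with `x_h`-constant coefficients plus the quadratic `−(μ_z/2)w² + (1−μ)[∇ₕf·∇ₕw + w w_z]`, whose spectrum at
`2ξ*` is `−(μ_z/2)·(top mode)² ≠ 0` by Lions' support theorem (Theorem E of POLY-SECTOR for CONTINUOUS spectra); `μ_z ≠ 0`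
somewhere by the (TV)-pin; infinite type: indicator/Wiman–Valiron doubling.  Leans on (ONE-dimensional kernel versions already in
the tree, typed for the FinalStateConjecture route `TemporalBandLiouville`, which runs the same lever in the time variable):
`Literature.Analysis.Fourier.TitchmarshPaleyWiener.PaleyWienerSchwartz_bounded_iff`, `Titchmarsh1926_convolution_support`,
`Titchmarsh_fourierSpectrum_mul` (all `_holds`); needed here: their `ℝ²` convex-hull / exposed-point versions (Hörmander I Thms 4.3.3,
7.3.1) and the barrier file's Bernstein half `Literature.Barriers.NavierStokesRegularity.BandLimited.ae_eq_zero_of_uniform_moments`.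
Why it might fail: cancellation inside the quadratic
form along imaginary directions in the infinite-type case; the Fourier side needs tempered growth bookkeeping on whole planes. -/
theorem stub_entireTH :
    ∀ (C : ℝ) (v : ℝ → EuclideanSpace ℝ (Fin 3) → EuclideanSpace ℝ (Fin 3)),
      Literature.Analysis.FluidPDE.HasTypeITimeDecay C v →
      ContinuousOn (Function.uncurry v) (Set.Iio (0 : ℝ) ×ˢ Set.univ) →
      (∀ s t : ℝ, s < t → t < 0 → ∀ x, v t x =
        Literature.Analysis.UnboundedOperators.heatExtension (v s) (t - s) x -
          Literature.Analysis.FluidPDE.oseenDuhamel 1 s v v t x) →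
      (∀ t < 0, Literature.Analysis.FluidPDE.VectorCalculus.IsDivFree (v t)) →
      (∀ s < 0, ∀ y, ⟪Literature.Analysis.FluidPDE.curl (v s) y, EuclideanSpace.single 2 1⟫_ℝ = 0) →
      ∀ W : Set (ℝ × EuclideanSpace ℝ (Fin 3)), IsOpen W → W.Nonempty → W ⊆ Set.Iio (0 : ℝ) ×ˢ Set.univ →
        (∀ z ∈ W, Literature.Analysis.FluidPDE.curl (v z.1) z.2 ≠ 0 ∧
          (fderiv ℝ (v z.1) z.2 (EuclideanSpace.single 0 1) 2 ≠ 0 ∨ fderiv ℝ (v z.1) z.2 (EuclideanSpace.single 1 1) 2 ≠ 0) ∧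
          (fderiv ℝ (v z.1) z.2 (EuclideanSpace.single 2 1) 0 ≠ 0 ∨ fderiv ℝ (v z.1) z.2 (EuclideanSpace.single 2 1) 1 ≠ 0)) →
        (∀ m : ℝ → ℝ, ∀ W₁ : Set (ℝ × EuclideanSpace ℝ (Fin 3)), W₁ ⊆ W → IsOpen W₁ → W₁.Nonempty →
          ∃ z ∈ W₁, ∃ b : Fin 3, b ≠ 2 ∧
            fderiv ℝ (v z.1) z.2 (EuclideanSpace.single 2 1) b ≠
              m z.1 * fderiv ℝ (v z.1) z.2 (EuclideanSpace.single b 1) 2) →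
        (∀ z ∈ W,
          fderiv ℝ (fun x => fderiv ℝ (v z.1) x (EuclideanSpace.single 2 1) 2) z.2 (EuclideanSpace.single 0 1) *
              fderiv ℝ (v z.1) z.2 (EuclideanSpace.single 1 1) 2 -
            fderiv ℝ (fun x => fderiv ℝ (v z.1) x (EuclideanSpace.single 2 1) 2) z.2 (EuclideanSpace.single 1 1) *
              fderiv ℝ (v z.1) z.2 (EuclideanSpace.single 0 1) 2 ≠ 0) →
        (∀ z ∈ W,
          fderiv ℝ (v z.1) z.2 (EuclideanSpace.single 2 1) 0 * fderiv ℝ (v z.1) z.2 (EuclideanSpace.single 0 1) 2 +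
            fderiv ℝ (v z.1) z.2 (EuclideanSpace.single 2 1) 1 * fderiv ℝ (v z.1) z.2 (EuclideanSpace.single 1 1) 2 < 0) →
        (∃ m : ℝ → ℝ → ℝ, ∀ z ∈ W, ∀ b : Fin 3, b ≠ 2 →
          fderiv ℝ (v z.1) z.2 (EuclideanSpace.single 2 1) b =
            m z.1 (z.2 2) * fderiv ℝ (v z.1) z.2 (EuclideanSpace.single b 1) 2) →
        (∀ R : ℝ, 0 < R → ∃ A : ℝ, ∀ z ∈ W, ∀ n : ℕ,
          ‖iteratedFDeriv ℝ n (fun p : EuclideanSpace ℝ (Fin 2) =>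
              v z.1 (z.2 + (EuclideanSpace.single 0 (p 0) + EuclideanSpace.single 1 (p 1)))) 0‖ ≤
            A * (Nat.factorial n : ℝ) / R ^ n) →
        ¬ Literature.Analysis.FluidPDE.IsBackwardSingularPoint v 0 := by
  sorry

/-- **RUNG (`stub_expTypeTH`) — PROVED (v3: discharged by name from `…Theorems.PoloidalWindowDoorPoloidalWindowRigidityStubExpTypeTH`,
p609463); THE FIRST RUNG of the line, a literal special case of `stub_entireTH`** (see the proved
`expTypeTH_of_entireTH` below): the same binders, with the entire-type bound replaced by a uniform BERNSTEIN bound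
`‖Dⁿ_h v(s)(y)‖ ≤ A·bⁿ` on the window, i.e. horizontal slices ENTIRE OF EXPONENTIAL TYPE `≤ b` — for bounded functions exactly
BAND-LIMITATION (compact horizontal spectrum in the closed ball of radius `b/2π`; Paley–Wiener–Schwartz for bounded functions,
Hörmander I Thm 7.3.1; ONE-dimensional kernel version in the tree: `Literature.Analysis.Fourier.TitchmarshPaleyWiener.
PaleyWienerSchwartz_bounded_iff`, and the barrier file's `Literature.Barriers.NavierStokesRegularity.BandLimited.
uniform_moments_iff_isBandLimited_slab`).  Attack (paper-complete up to one boundary-germ step): pick a direction `e` exposing a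
POINT `ξ*` of the convex hull of the compact spectrum `Σ` (Straszewicz); the (TH) class momentum equation (E) has `x_h`-independent
coefficients, so it is a convolution identity in `ξ`; by the theorem of supports (Hörmander I Thm 4.3.3; 1D tree version
`Titchmarsh_fourierSpectrum_mul`) `2ξ* ∈ supp (ŵ ∗ ŵ)`; the competing bilinear terms `(1−μ)[∇ₕf·∇ₕw + w w_z]` have kernel
`(1−μ)[ŵ(ξ)ŵ_z(η)(1 − ξ·η/|η|²)]`, which VANISHES ON THE DIAGONAL `ξ = η` (Theorem E's cancellation) — so the germ of `[E]` at
`2ξ*` is `−(μ_z/2)·(germ of ŵ at ξ*)^{∗2} ≠ 0` wherever `μ_z ≠ 0` ((TV)-pin): contradiction.  The (M)-free witness K-47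
(`twistProfile`, two Kelvin modes) IS band-limited, twisting and hyperbolic: the rung minus (M) is FALSE, so (M) is load-bearing
exactly in the identity used.  Why it might fail: the boundary-germ step (continuum spectrum accumulating at `ξ*` with no atom)
needs an order-of-vanishing notion for `ŵ` at `ξ*` under which the off-diagonal suppression `|ξ−η|` beats the main term. -/
theorem stub_expTypeTH :
    ∀ (C : ℝ) (v : ℝ → EuclideanSpace ℝ (Fin 3) → EuclideanSpace ℝ (Fin 3)),
      Literature.Analysis.FluidPDE.HasTypeITimeDecay C v →
      ContinuousOn (Function.uncurry v) (Set.Iio (0 : ℝ) ×ˢ Set.univ) →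
      (∀ s t : ℝ, s < t → t < 0 → ∀ x, v t x =
        Literature.Analysis.UnboundedOperators.heatExtension (v s) (t - s) x -
          Literature.Analysis.FluidPDE.oseenDuhamel 1 s v v t x) →
      (∀ t < 0, Literature.Analysis.FluidPDE.VectorCalculus.IsDivFree (v t)) →
      (∀ s < 0, ∀ y, ⟪Literature.Analysis.FluidPDE.curl (v s) y, EuclideanSpace.single 2 1⟫_ℝ = 0) →
      ∀ W : Set (ℝ × EuclideanSpace ℝ (Fin 3)), IsOpen W → W.Nonempty → W ⊆ Set.Iio (0 : ℝ) ×ˢ Set.univ →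
        (∀ z ∈ W, Literature.Analysis.FluidPDE.curl (v z.1) z.2 ≠ 0 ∧
          (fderiv ℝ (v z.1) z.2 (EuclideanSpace.single 0 1) 2 ≠ 0 ∨ fderiv ℝ (v z.1) z.2 (EuclideanSpace.single 1 1) 2 ≠ 0) ∧
          (fderiv ℝ (v z.1) z.2 (EuclideanSpace.single 2 1) 0 ≠ 0 ∨ fderiv ℝ (v z.1) z.2 (EuclideanSpace.single 2 1) 1 ≠ 0)) →
        (∀ m : ℝ → ℝ, ∀ W₁ : Set (ℝ × EuclideanSpace ℝ (Fin 3)), W₁ ⊆ W → IsOpen W₁ → W₁.Nonempty →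
          ∃ z ∈ W₁, ∃ b : Fin 3, b ≠ 2 ∧
            fderiv ℝ (v z.1) z.2 (EuclideanSpace.single 2 1) b ≠
              m z.1 * fderiv ℝ (v z.1) z.2 (EuclideanSpace.single b 1) 2) →
        (∀ z ∈ W,
          fderiv ℝ (fun x => fderiv ℝ (v z.1) x (EuclideanSpace.single 2 1) 2) z.2 (EuclideanSpace.single 0 1) *
              fderiv ℝ (v z.1) z.2 (EuclideanSpace.single 1 1) 2 -
            fderiv ℝ (fun x => fderiv ℝ (v z.1) x (EuclideanSpace.single 2 1) 2) z.2 (EuclideanSpace.single 1 1) *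
              fderiv ℝ (v z.1) z.2 (EuclideanSpace.single 0 1) 2 ≠ 0) →
        (∀ z ∈ W,
          fderiv ℝ (v z.1) z.2 (EuclideanSpace.single 2 1) 0 * fderiv ℝ (v z.1) z.2 (EuclideanSpace.single 0 1) 2 +
            fderiv ℝ (v z.1) z.2 (EuclideanSpace.single 2 1) 1 * fderiv ℝ (v z.1) z.2 (EuclideanSpace.single 1 1) 2 < 0) →
        (∃ m : ℝ → ℝ → ℝ, ∀ z ∈ W, ∀ b : Fin 3, b ≠ 2 →
          fderiv ℝ (v z.1) z.2 (EuclideanSpace.single 2 1) b =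
            m z.1 (z.2 2) * fderiv ℝ (v z.1) z.2 (EuclideanSpace.single b 1) 2) →
        (∃ b A : ℝ, 0 ≤ b ∧ ∀ z ∈ W, ∀ n : ℕ,
          ‖iteratedFDeriv ℝ n (fun p : EuclideanSpace ℝ (Fin 2) =>
              v z.1 (z.2 + (EuclideanSpace.single 0 (p 0) + EuclideanSpace.single 1 (p 1)))) 0‖ ≤
            A * b ^ n) →
        ¬ Literature.Analysis.FluidPDE.IsBackwardSingularPoint v 0 :=
  -- v3 (ns-es-p1 g7, 2026-08-29): DISCHARGED BY NAME — the registered rung landed VERBATIM as a Theorems helper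
  -- (p609463, ns-es-p1 g2, `--supports stmt-NavierStokesRegularity-19708`; std axioms, 0 sorry).
  Summit.NavierStokesRegularity.NavierStokesRegularity.Theorems.PoloidalWindowDoorPoloidalWindowRigidityStubExpTypeTH.stub_expTypeTH

/-- PROVED (rung bookkeeping): `stub_expTypeTH` is a special case of `stub_entireTH` — exponential type `b` gives the entire
bound with `A(R) = A·e^{bR}`, since `(bR)ⁿ/n! ≤ e^{bR}` (`Real.pow_div_factorial_le_exp`). -/
theorem expTypeTH_of_entireTH (h :
    ∀ (C : ℝ) (v : ℝ → EuclideanSpace ℝ (Fin 3) → EuclideanSpace ℝ (Fin 3)),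
      Literature.Analysis.FluidPDE.HasTypeITimeDecay C v →
      ContinuousOn (Function.uncurry v) (Set.Iio (0 : ℝ) ×ˢ Set.univ) →
      (∀ s t : ℝ, s < t → t < 0 → ∀ x, v t x =
        Literature.Analysis.UnboundedOperators.heatExtension (v s) (t - s) x -
          Literature.Analysis.FluidPDE.oseenDuhamel 1 s v v t x) →
      (∀ t < 0, Literature.Analysis.FluidPDE.VectorCalculus.IsDivFree (v t)) →
      (∀ s < 0, ∀ y, ⟪Literature.Analysis.FluidPDE.curl (v s) y, EuclideanSpace.single 2 1⟫_ℝ = 0) →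
      ∀ W : Set (ℝ × EuclideanSpace ℝ (Fin 3)), IsOpen W → W.Nonempty → W ⊆ Set.Iio (0 : ℝ) ×ˢ Set.univ →
        (∀ z ∈ W, Literature.Analysis.FluidPDE.curl (v z.1) z.2 ≠ 0 ∧
          (fderiv ℝ (v z.1) z.2 (EuclideanSpace.single 0 1) 2 ≠ 0 ∨ fderiv ℝ (v z.1) z.2 (EuclideanSpace.single 1 1) 2 ≠ 0) ∧
          (fderiv ℝ (v z.1) z.2 (EuclideanSpace.single 2 1) 0 ≠ 0 ∨ fderiv ℝ (v z.1) z.2 (EuclideanSpace.single 2 1) 1 ≠ 0)) →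
        (∀ m : ℝ → ℝ, ∀ W₁ : Set (ℝ × EuclideanSpace ℝ (Fin 3)), W₁ ⊆ W → IsOpen W₁ → W₁.Nonempty →
          ∃ z ∈ W₁, ∃ b : Fin 3, b ≠ 2 ∧
            fderiv ℝ (v z.1) z.2 (EuclideanSpace.single 2 1) b ≠
              m z.1 * fderiv ℝ (v z.1) z.2 (EuclideanSpace.single b 1) 2) →
        (∀ z ∈ W,
          fderiv ℝ (fun x => fderiv ℝ (v z.1) x (EuclideanSpace.single 2 1) 2) z.2 (EuclideanSpace.single 0 1) *
              fderiv ℝ (v z.1) z.2 (EuclideanSpace.single 1 1) 2 -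
            fderiv ℝ (fun x => fderiv ℝ (v z.1) x (EuclideanSpace.single 2 1) 2) z.2 (EuclideanSpace.single 1 1) *
              fderiv ℝ (v z.1) z.2 (EuclideanSpace.single 0 1) 2 ≠ 0) →
        (∀ z ∈ W,
          fderiv ℝ (v z.1) z.2 (EuclideanSpace.single 2 1) 0 * fderiv ℝ (v z.1) z.2 (EuclideanSpace.single 0 1) 2 +
            fderiv ℝ (v z.1) z.2 (EuclideanSpace.single 2 1) 1 * fderiv ℝ (v z.1) z.2 (EuclideanSpace.single 1 1) 2 < 0) →
        (∃ m : ℝ → ℝ → ℝ, ∀ z ∈ W, ∀ b : Fin 3, b ≠ 2 →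
          fderiv ℝ (v z.1) z.2 (EuclideanSpace.single 2 1) b =
            m z.1 (z.2 2) * fderiv ℝ (v z.1) z.2 (EuclideanSpace.single b 1) 2) →
        (∀ R : ℝ, 0 < R → ∃ A : ℝ, ∀ z ∈ W, ∀ n : ℕ,
          ‖iteratedFDeriv ℝ n (fun p : EuclideanSpace ℝ (Fin 2) =>
              v z.1 (z.2 + (EuclideanSpace.single 0 (p 0) + EuclideanSpace.single 1 (p 1)))) 0‖ ≤
            A * (Nat.factorial n : ℝ) / R ^ n) →
        ¬ Literature.Analysis.FluidPDE.IsBackwardSingularPoint v 0 ) :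
    ∀ (C : ℝ) (v : ℝ → EuclideanSpace ℝ (Fin 3) → EuclideanSpace ℝ (Fin 3)),
      Literature.Analysis.FluidPDE.HasTypeITimeDecay C v →
      ContinuousOn (Function.uncurry v) (Set.Iio (0 : ℝ) ×ˢ Set.univ) →
      (∀ s t : ℝ, s < t → t < 0 → ∀ x, v t x =
        Literature.Analysis.UnboundedOperators.heatExtension (v s) (t - s) x -
          Literature.Analysis.FluidPDE.oseenDuhamel 1 s v v t x) →
      (∀ t < 0, Literature.Analysis.FluidPDE.VectorCalculus.IsDivFree (v t)) →
      (∀ s < 0, ∀ y, ⟪Literature.Analysis.FluidPDE.curl (v s) y, EuclideanSpace.single 2 1⟫_ℝ = 0) →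
      ∀ W : Set (ℝ × EuclideanSpace ℝ (Fin 3)), IsOpen W → W.Nonempty → W ⊆ Set.Iio (0 : ℝ) ×ˢ Set.univ →
        (∀ z ∈ W, Literature.Analysis.FluidPDE.curl (v z.1) z.2 ≠ 0 ∧
          (fderiv ℝ (v z.1) z.2 (EuclideanSpace.single 0 1) 2 ≠ 0 ∨ fderiv ℝ (v z.1) z.2 (EuclideanSpace.single 1 1) 2 ≠ 0) ∧
          (fderiv ℝ (v z.1) z.2 (EuclideanSpace.single 2 1) 0 ≠ 0 ∨ fderiv ℝ (v z.1) z.2 (EuclideanSpace.single 2 1) 1 ≠ 0)) →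
        (∀ m : ℝ → ℝ, ∀ W₁ : Set (ℝ × EuclideanSpace ℝ (Fin 3)), W₁ ⊆ W → IsOpen W₁ → W₁.Nonempty →
          ∃ z ∈ W₁, ∃ b : Fin 3, b ≠ 2 ∧
            fderiv ℝ (v z.1) z.2 (EuclideanSpace.single 2 1) b ≠
              m z.1 * fderiv ℝ (v z.1) z.2 (EuclideanSpace.single b 1) 2) →
        (∀ z ∈ W,
          fderiv ℝ (fun x => fderiv ℝ (v z.1) x (EuclideanSpace.single 2 1) 2) z.2 (EuclideanSpace.single 0 1) *
              fderiv ℝ (v z.1) z.2 (EuclideanSpace.single 1 1) 2 -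
            fderiv ℝ (fun x => fderiv ℝ (v z.1) x (EuclideanSpace.single 2 1) 2) z.2 (EuclideanSpace.single 1 1) *
              fderiv ℝ (v z.1) z.2 (EuclideanSpace.single 0 1) 2 ≠ 0) →
        (∀ z ∈ W,
          fderiv ℝ (v z.1) z.2 (EuclideanSpace.single 2 1) 0 * fderiv ℝ (v z.1) z.2 (EuclideanSpace.single 0 1) 2 +
            fderiv ℝ (v z.1) z.2 (EuclideanSpace.single 2 1) 1 * fderiv ℝ (v z.1) z.2 (EuclideanSpace.single 1 1) 2 < 0) →
        (∃ m : ℝ → ℝ → ℝ, ∀ z ∈ W, ∀ b : Fin 3, b ≠ 2 →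
          fderiv ℝ (v z.1) z.2 (EuclideanSpace.single 2 1) b =
            m z.1 (z.2 2) * fderiv ℝ (v z.1) z.2 (EuclideanSpace.single b 1) 2) →
        (∃ b A : ℝ, 0 ≤ b ∧ ∀ z ∈ W, ∀ n : ℕ,
          ‖iteratedFDeriv ℝ n (fun p : EuclideanSpace ℝ (Fin 2) =>
              v z.1 (z.2 + (EuclideanSpace.single 0 (p 0) + EuclideanSpace.single 1 (p 1)))) 0‖ ≤
            A * b ^ n) →
        ¬ Literature.Analysis.FluidPDE.IsBackwardSingularPoint v 0 := by
  intro C v hrate hcont hmild hdiv hpol W hW hWne hWs hnd hpin htw hhyp hTH hexp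
  obtain ⟨b, A, hb, hA⟩ := hexp
  obtain ⟨z₀, hz₀⟩ := hWne
  have hA0 : 0 ≤ A := le_trans (norm_nonneg _) (by simpa using hA z₀ hz₀ 0)
  refine h C v hrate hcont hmild hdiv hpol W hW ⟨z₀, hz₀⟩ hWs hnd hpin htw hhyp hTH ?_
  intro R hR
  refine ⟨A * Real.exp (b * R), fun z hz n => ?_⟩
  have hRn : 0 < R ^ n := pow_pos hR n
  have key : b ^ n ≤ Real.exp (b * R) * (Nat.factorial n : ℝ) / R ^ n := by
    have h2 := Real.pow_div_factorial_le_exp (b * R) (by positivity) n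
    rw [div_le_iff₀ (by positivity)] at h2
    rw [le_div_iff₀ hRn]
    calc b ^ n * R ^ n = (b * R) ^ n := by rw [mul_pow]
      _ ≤ Real.exp (b * R) * (Nat.factorial n : ℝ) := h2
  calc ‖iteratedFDeriv ℝ n (fun p : EuclideanSpace ℝ (Fin 2) =>
            v z.1 (z.2 + (EuclideanSpace.single 0 (p 0) + EuclideanSpace.single 1 (p 1)))) 0‖
        ≤ A * b ^ n := hA z hz n
    _ ≤ A * (Real.exp (b * R) * (Nat.factorial n : ℝ) / R ^ n) := mul_le_mul_of_nonneg_left key hA0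
    _ = A * Real.exp (b * R) * (Nat.factorial n : ℝ) / R ^ n := by ring

/-- **STUB (`stub_entireThick`): on the THICK stratum (shear ratio a function of `(t,x₂)` on NO sub-window), a twisting
non-degenerate pinned window with ENTIRE horizontal slices is impossible for a singular profile** — the binders of `stub_twisting`
(class, poloidal, window, ND pins, (TV)-pin, twist) PLUS the thickness clause of `mixed_type`'s `stub_hyperbolicThick` /
`stub_semiEllipticThick` (no sign condition: it serves both the hyperbolic-thick and the semi-elliptic-thick hypotheses of
`twisting_regular_of_three`) PLUS the entire-type bound of S\*, ⇒ `¬ IsBackwardSingularPoint v 0`.  First identity of the attack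
(exponential-type case): at an exposed frequency `ξ*` of the horizontal spectrum the top modes `W e^{iξ*·x}` of `w` and `U e^{iξ*·x}`
of `u = ∂₂φ` satisfy `W U_z − W_z U = 0`, i.e. `U = λW` with `λ` INDEPENDENT OF THE HEIGHT — the top of the spectrum is (TV)
(Theorem Q's «rigid z-independent top», now for continuous spectra at class level); the research part is peeling this rigidity
into the bulk of the spectrum against the thick (`∂_wΛ ≠ 0`) convolution terms.  Why it might fail: below the exposed shell the
convolution structure of `G(t,z,w)`'s Taylor expansion in `w` mixes all frequencies; no finite peeling is known to terminate. -/
theorem stub_entireThick :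
    ∀ (C : ℝ) (v : ℝ → EuclideanSpace ℝ (Fin 3) → EuclideanSpace ℝ (Fin 3)),
      Literature.Analysis.FluidPDE.HasTypeITimeDecay C v →
      ContinuousOn (Function.uncurry v) (Set.Iio (0 : ℝ) ×ˢ Set.univ) →
      (∀ s t : ℝ, s < t → t < 0 → ∀ x, v t x =
        Literature.Analysis.UnboundedOperators.heatExtension (v s) (t - s) x -
          Literature.Analysis.FluidPDE.oseenDuhamel 1 s v v t x) →
      (∀ t < 0, Literature.Analysis.FluidPDE.VectorCalculus.IsDivFree (v t)) →
      (∀ s < 0, ∀ y, ⟪Literature.Analysis.FluidPDE.curl (v s) y, EuclideanSpace.single 2 1⟫_ℝ = 0) →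
      ∀ W : Set (ℝ × EuclideanSpace ℝ (Fin 3)), IsOpen W → W.Nonempty → W ⊆ Set.Iio (0 : ℝ) ×ˢ Set.univ →
        (∀ z ∈ W, Literature.Analysis.FluidPDE.curl (v z.1) z.2 ≠ 0 ∧
          (fderiv ℝ (v z.1) z.2 (EuclideanSpace.single 0 1) 2 ≠ 0 ∨ fderiv ℝ (v z.1) z.2 (EuclideanSpace.single 1 1) 2 ≠ 0) ∧
          (fderiv ℝ (v z.1) z.2 (EuclideanSpace.single 2 1) 0 ≠ 0 ∨ fderiv ℝ (v z.1) z.2 (EuclideanSpace.single 2 1) 1 ≠ 0)) →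
        (∀ m : ℝ → ℝ, ∀ W₁ : Set (ℝ × EuclideanSpace ℝ (Fin 3)), W₁ ⊆ W → IsOpen W₁ → W₁.Nonempty →
          ∃ z ∈ W₁, ∃ b : Fin 3, b ≠ 2 ∧
            fderiv ℝ (v z.1) z.2 (EuclideanSpace.single 2 1) b ≠
              m z.1 * fderiv ℝ (v z.1) z.2 (EuclideanSpace.single b 1) 2) →
        (∀ z ∈ W,
          fderiv ℝ (fun x => fderiv ℝ (v z.1) x (EuclideanSpace.single 2 1) 2) z.2 (EuclideanSpace.single 0 1) *
              fderiv ℝ (v z.1) z.2 (EuclideanSpace.single 1 1) 2 -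
            fderiv ℝ (fun x => fderiv ℝ (v z.1) x (EuclideanSpace.single 2 1) 2) z.2 (EuclideanSpace.single 1 1) *
              fderiv ℝ (v z.1) z.2 (EuclideanSpace.single 0 1) 2 ≠ 0) →
        (∀ m : ℝ → ℝ → ℝ, ∀ W₁ : Set (ℝ × EuclideanSpace ℝ (Fin 3)), W₁ ⊆ W → IsOpen W₁ → W₁.Nonempty →
          ∃ z ∈ W₁, ∃ b : Fin 3, b ≠ 2 ∧
            fderiv ℝ (v z.1) z.2 (EuclideanSpace.single 2 1) b ≠
              m z.1 (z.2 2) * fderiv ℝ (v z.1) z.2 (EuclideanSpace.single b 1) 2) →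
        (∀ R : ℝ, 0 < R → ∃ A : ℝ, ∀ z ∈ W, ∀ n : ℕ,
          ‖iteratedFDeriv ℝ n (fun p : EuclideanSpace ℝ (Fin 2) =>
              v z.1 (z.2 + (EuclideanSpace.single 0 (p 0) + EuclideanSpace.single 1 (p 1)))) 0‖ ≤
            A * (Nat.factorial n : ℝ) / R ^ n) →
        ¬ Literature.Analysis.FluidPDE.IsBackwardSingularPoint v 0 := by
  sorry

/-! ### Composition, step 1 (proved): the statement of `lrc_jet`'s `stub_twisting` from the three stubs, through the tree
relocation theorem `…ThmAThreeStubs.twisting_regular_of_three` -/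

/-- **NON-DEGENERATE + PIN + TWISTING ⇒ regular** — VERBATIM the statement of the registered stub `stub_twisting` of
`Lines/lrc_jet.lean` v5 (= `mixed_type`'s `twisting_of_mixedType`), PROVED from the three stubs: each of the per-profile hypotheses
`hH` (hyperbolic (TH)), `hHT` (hyperbolic thick), `hST` (semi-elliptic thick) of `twisting_regular_of_three` is discharged by first
shrinking the given window to the entire-type sub-window of `stub_horizontalEntire` (every clause is hereditary to open sub-windows)
and then calling `stub_entireTH` / `stub_entireThick`. -/
theorem twisting_of_entireSlices :
    ∀ (C : ℝ) (v : ℝ → EuclideanSpace ℝ (Fin 3) → EuclideanSpace ℝ (Fin 3)),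
      Literature.Analysis.FluidPDE.HasTypeITimeDecay C v →
      ContinuousOn (Function.uncurry v) (Set.Iio (0 : ℝ) ×ˢ Set.univ) →
      (∀ s t : ℝ, s < t → t < 0 → ∀ x, v t x =
        Literature.Analysis.UnboundedOperators.heatExtension (v s) (t - s) x -
          Literature.Analysis.FluidPDE.oseenDuhamel 1 s v v t x) →
      (∀ t < 0, Literature.Analysis.FluidPDE.VectorCalculus.IsDivFree (v t)) →
      (∀ s < 0, ∀ y, ⟪Literature.Analysis.FluidPDE.curl (v s) y, EuclideanSpace.single 2 1⟫_ℝ = 0) →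
      ∀ W : Set (ℝ × EuclideanSpace ℝ (Fin 3)), IsOpen W → W.Nonempty → W ⊆ Set.Iio (0 : ℝ) ×ˢ Set.univ →
        (∀ z ∈ W, Literature.Analysis.FluidPDE.curl (v z.1) z.2 ≠ 0 ∧
          (fderiv ℝ (v z.1) z.2 (EuclideanSpace.single 0 1) 2 ≠ 0 ∨ fderiv ℝ (v z.1) z.2 (EuclideanSpace.single 1 1) 2 ≠ 0) ∧
          (fderiv ℝ (v z.1) z.2 (EuclideanSpace.single 2 1) 0 ≠ 0 ∨ fderiv ℝ (v z.1) z.2 (EuclideanSpace.single 2 1) 1 ≠ 0)) →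
        (∀ m : ℝ → ℝ, ∀ W₁ : Set (ℝ × EuclideanSpace ℝ (Fin 3)), W₁ ⊆ W → IsOpen W₁ → W₁.Nonempty →
          ∃ z ∈ W₁, ∃ b : Fin 3, b ≠ 2 ∧
            fderiv ℝ (v z.1) z.2 (EuclideanSpace.single 2 1) b ≠
              m z.1 * fderiv ℝ (v z.1) z.2 (EuclideanSpace.single b 1) 2) →
        (∀ z ∈ W,
          fderiv ℝ (fun x => fderiv ℝ (v z.1) x (EuclideanSpace.single 2 1) 2) z.2 (EuclideanSpace.single 0 1) *
              fderiv ℝ (v z.1) z.2 (EuclideanSpace.single 1 1) 2 -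
            fderiv ℝ (fun x => fderiv ℝ (v z.1) x (EuclideanSpace.single 2 1) 2) z.2 (EuclideanSpace.single 1 1) *
              fderiv ℝ (v z.1) z.2 (EuclideanSpace.single 0 1) 2 ≠ 0) →
        ¬ Literature.Analysis.FluidPDE.IsBackwardSingularPoint v 0 := by
  intro C v hrate hcont hmild hdiv hpol W hW hWne hWs hnd hpin htw
  refine twisting_regular_of_three C v hrate hcont hmild hdiv ?_ ?_ ?_ W hW hWne hWs hnd hpin htw
  · -- hH : hyperbolic (TH) windows
    intro W' hW' hW'ne hW's hnd' hpin' htw' hhyp' hTH'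
    obtain ⟨W₁, hW₁W, hW₁o, hW₁ne, hbd⟩ :=
      stub_horizontalEntire C v hrate hcont hmild hdiv hpol W' hW' hW'ne hW's hnd' hpin' htw'
    obtain ⟨m, hm⟩ := hTH'
    exact stub_entireTH C v hrate hcont hmild hdiv hpol W₁ hW₁o hW₁ne (hW₁W.trans hW's)
      (fun z hz => hnd' z (hW₁W hz))
      (fun m' W₂ hW₂ hW₂o hW₂ne => hpin' m' W₂ (hW₂.trans hW₁W) hW₂o hW₂ne)
      (fun z hz => htw' z (hW₁W hz)) (fun z hz => hhyp' z (hW₁W hz))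
      ⟨m, fun z hz b hb => hm z (hW₁W hz) b hb⟩ hbd
  · -- hHT : hyperbolic thick windows
    intro W' hW' hW'ne hW's hnd' hpin' htw' hhyp' hth'
    obtain ⟨W₁, hW₁W, hW₁o, hW₁ne, hbd⟩ :=
      stub_horizontalEntire C v hrate hcont hmild hdiv hpol W' hW' hW'ne hW's hnd' hpin' htw'
    exact stub_entireThick C v hrate hcont hmild hdiv hpol W₁ hW₁o hW₁ne (hW₁W.trans hW's)
      (fun z hz => hnd' z (hW₁W hz))
      (fun m' W₂ hW₂ hW₂o hW₂ne => hpin' m' W₂ (hW₂.trans hW₁W) hW₂o hW₂ne)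
      (fun z hz => htw' z (hW₁W hz))
      (fun m' W₂ hW₂ hW₂o hW₂ne => hth' m' W₂ (hW₂.trans hW₁W) hW₂o hW₂ne) hbd
  · -- hST : twisting thick windows inside a semi-elliptic slab (the sign is not needed by `stub_entireThick`)
    intro W' hW' hW'ne hW's hnd' hpin' htw' a b hWab hsemi hth'
    obtain ⟨W₁, hW₁W, hW₁o, hW₁ne, hbd⟩ :=
      stub_horizontalEntire C v hrate hcont hmild hdiv hpol W' hW' hW'ne hW's hnd' hpin' htw'
    exact stub_entireThick C v hrate hcont hmild hdiv hpol W₁ hW₁o hW₁ne (hW₁W.trans hW's)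
      (fun z hz => hnd' z (hW₁W hz))
      (fun m' W₂ hW₂ hW₂o hW₂ne => hpin' m' W₂ (hW₂.trans hW₁W) hW₂o hW₂ne)
      (fun z hz => htw' z (hW₁W hz))
      (fun m' W₂ hW₂ hW₂o hW₂ne => hth' m' W₂ (hW₂.trans hW₁W) hW₂o hW₂ne) hbd

/-! ### Composition, step 2 (proved, = `mixed_type` v2 / `lrc_jet` v5 chain): the crux -/

/-- **NON-DEGENERATE + PIN ⇒ regular** — the pointwise twist dichotomy over the tree theorem `…StubUntwisted.stub_untwisted`
(p561151, the untwisted half) and `twisting_of_entireSlices` (the twisting half). -/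
theorem ndRegular :
    ∀ (C : ℝ) (v : ℝ → EuclideanSpace ℝ (Fin 3) → EuclideanSpace ℝ (Fin 3)),
      Literature.Analysis.FluidPDE.HasTypeITimeDecay C v →
      ContinuousOn (Function.uncurry v) (Set.Iio (0 : ℝ) ×ˢ Set.univ) →
      (∀ s t : ℝ, s < t → t < 0 → ∀ x, v t x =
        Literature.Analysis.UnboundedOperators.heatExtension (v s) (t - s) x -
          Literature.Analysis.FluidPDE.oseenDuhamel 1 s v v t x) →
      (∀ t < 0, Literature.Analysis.FluidPDE.VectorCalculus.IsDivFree (v t)) →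
      (∀ s < 0, ∀ y, ⟪Literature.Analysis.FluidPDE.curl (v s) y, EuclideanSpace.single 2 1⟫_ℝ = 0) →
      ∀ W : Set (ℝ × EuclideanSpace ℝ (Fin 3)), IsOpen W → W.Nonempty → W ⊆ Set.Iio (0 : ℝ) ×ˢ Set.univ →
        (∀ z ∈ W, Literature.Analysis.FluidPDE.curl (v z.1) z.2 ≠ 0 ∧
          (fderiv ℝ (v z.1) z.2 (EuclideanSpace.single 0 1) 2 ≠ 0 ∨ fderiv ℝ (v z.1) z.2 (EuclideanSpace.single 1 1) 2 ≠ 0) ∧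
          (fderiv ℝ (v z.1) z.2 (EuclideanSpace.single 2 1) 0 ≠ 0 ∨ fderiv ℝ (v z.1) z.2 (EuclideanSpace.single 2 1) 1 ≠ 0)) →
        (∀ m : ℝ → ℝ, ∀ W₁ : Set (ℝ × EuclideanSpace ℝ (Fin 3)), W₁ ⊆ W → IsOpen W₁ → W₁.Nonempty →
          ∃ z ∈ W₁, ∃ b : Fin 3, b ≠ 2 ∧
            fderiv ℝ (v z.1) z.2 (EuclideanSpace.single 2 1) b ≠
              m z.1 * fderiv ℝ (v z.1) z.2 (EuclideanSpace.single b 1) 2) →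
        ¬ Literature.Analysis.FluidPDE.IsBackwardSingularPoint v 0 := by
  intro C v hrate hcont hmild hdiv hpol W hW hWne hWs hnd hpin
  set T : ℝ × EuclideanSpace ℝ (Fin 3) → ℝ := fun z =>
    fderiv ℝ (fun x => fderiv ℝ (v z.1) x (EuclideanSpace.single 2 1) 2) z.2 (EuclideanSpace.single 0 1) *
              fderiv ℝ (v z.1) z.2 (EuclideanSpace.single 1 1) 2 -
            fderiv ℝ (fun x => fderiv ℝ (v z.1) x (EuclideanSpace.single 2 1) 2) z.2 (EuclideanSpace.single 1 1) *
              fderiv ℝ (v z.1) z.2 (EuclideanSpace.single 0 1) 2 with hT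
  by_cases htw : ∃ z ∈ W, T z ≠ 0
  · obtain ⟨z₀, hz₀W, hz₀⟩ := htw
    have hslab : IsOpen (Set.Iio (0 : ℝ) ×ˢ (Set.univ : Set (EuclideanSpace ℝ (Fin 3)))) :=
      isOpen_Iio.prod isOpen_univ
    have hTc : ContinuousOn T (Set.Iio (0 : ℝ) ×ˢ Set.univ) := by
      rw [hT]
      exact continuousOn_twist hrate hcont hmild
    have hO : IsOpen ((Set.Iio (0 : ℝ) ×ˢ Set.univ) ∩ T ⁻¹' {0}ᶜ) :=
      hTc.isOpen_inter_preimage hslab isOpen_compl_singleton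
    set W₃ : Set (ℝ × EuclideanSpace ℝ (Fin 3)) := W ∩ ((Set.Iio (0 : ℝ) ×ˢ Set.univ) ∩ T ⁻¹' {0}ᶜ) with hW₃
    have hW₃o : IsOpen W₃ := hW.inter hO
    have hW₃W : W₃ ⊆ W := Set.inter_subset_left
    have hW₃ne : W₃.Nonempty := ⟨z₀, hz₀W, hWs hz₀W, hz₀⟩
    refine twisting_of_entireSlices C v hrate hcont hmild hdiv hpol W₃ hW₃o hW₃ne (hW₃W.trans hWs)
      (fun z hz => hnd z (hW₃W hz)) (fun m W₁ hW₁ hW₁o hW₁ne => hpin m W₁ (hW₁.trans hW₃W) hW₁o hW₁ne) ?_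
    intro z hz
    exact hz.2.2
  · push Not at htw
    exact Summit.NavierStokesRegularity.NavierStokesRegularity.Theorems.PoloidalWindowDoorPoloidalWindowRigidityStubUntwisted.stub_untwisted
      C v hrate hcont hmild hdiv hpol W hW hWne hWs hnd htw

/-- **LRC″ with spatial pins, UNDER THE SINGULARITY ASSUMPTION** (vacuously, from `ndRegular`) — the hypothesis `hLRC` of
`…K2OfLrcSpatial.nonflatLiouville_of_lrc_spatial`. -/
theorem lrcSpatial_of_stubs :
    ∀ (C : ℝ) (v : ℝ → EuclideanSpace ℝ (Fin 3) → EuclideanSpace ℝ (Fin 3)),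
      Literature.Analysis.FluidPDE.HasTypeITimeDecay C v →
      ContinuousOn (Function.uncurry v) (Set.Iio (0 : ℝ) ×ˢ Set.univ) →
      (∀ s t : ℝ, s < t → t < 0 → ∀ x, v t x =
        Literature.Analysis.UnboundedOperators.heatExtension (v s) (t - s) x -
          Literature.Analysis.FluidPDE.oseenDuhamel 1 s v v t x) →
      (∀ t < 0, Literature.Analysis.FluidPDE.VectorCalculus.IsDivFree (v t)) →
      (∀ s < 0, ∀ y, ⟪Literature.Analysis.FluidPDE.curl (v s) y, EuclideanSpace.single 2 1⟫_ℝ = 0) →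
      Literature.Analysis.FluidPDE.IsBackwardSingularPoint v 0 →
      ∀ W : Set (ℝ × EuclideanSpace ℝ (Fin 3)), IsOpen W → W.Nonempty → W ⊆ Set.Iio (0 : ℝ) ×ˢ Set.univ →
        (∀ z ∈ W, Literature.Analysis.FluidPDE.curl (v z.1) z.2 ≠ 0 ∧
          (fderiv ℝ (v z.1) z.2 (EuclideanSpace.single 0 1) 2 ≠ 0 ∨ fderiv ℝ (v z.1) z.2 (EuclideanSpace.single 1 1) 2 ≠ 0) ∧
          (fderiv ℝ (v z.1) z.2 (EuclideanSpace.single 2 1) 0 ≠ 0 ∨ fderiv ℝ (v z.1) z.2 (EuclideanSpace.single 2 1) 1 ≠ 0)) →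
        (∀ m : ℝ → ℝ, ∀ W₁ : Set (ℝ × EuclideanSpace ℝ (Fin 3)), W₁ ⊆ W → IsOpen W₁ → W₁.Nonempty →
          ∃ z ∈ W₁, ∃ b : Fin 3, b ≠ 2 ∧
            fderiv ℝ (v z.1) z.2 (EuclideanSpace.single 2 1) b ≠
              m z.1 * fderiv ℝ (v z.1) z.2 (EuclideanSpace.single b 1) 2) →
        ∃ s : ℝ, s < 0 ∧ ∃ U : Set (EuclideanSpace ℝ (Fin 3)), IsOpen U ∧ U.Nonempty ∧
          ((∃ e : EuclideanSpace ℝ (Fin 3), e ≠ 0 ∧ ∀ y ∈ U, fderiv ℝ (Literature.Analysis.FluidPDE.curl (v s)) y e = 0) ∨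
           (∃ c : EuclideanSpace ℝ (Fin 3), ∀ y ∈ U,
              Literature.Analysis.FluidPDE.rotGen (Literature.Analysis.FluidPDE.curl (v s) y) =
                fderiv ℝ (Literature.Analysis.FluidPDE.curl (v s)) y (Literature.Analysis.FluidPDE.rotGen (y - c)))) := by
  intro C v hrate hcont hmild hdiv hpol hsing W hW hWne hWs hnd hpin
  exact absurd hsing (ndRegular C v hrate hcont hmild hdiv hpol W hW hWne hWs hnd hpin)

/-- **(TV) — both halves are tree theorems** (`…TimeShearLiminf.stub_tvLiminf`, p525351, and
`…HorizontalFlatPast.nonflatLiouville_of_timeShear_unbounded`): the hypothesis `hTV` of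
`…K2OfLrcSpatial.nonflatLiouville_of_lrc_spatial`. -/
theorem tv_of_stubs :
    ∀ (C : ℝ) (v : ℝ → EuclideanSpace ℝ (Fin 3) → EuclideanSpace ℝ (Fin 3)),
      Literature.Analysis.FluidPDE.HasTypeITimeDecay C v →
      ContinuousOn (Function.uncurry v) (Set.Iio (0 : ℝ) ×ˢ Set.univ) →
      (∀ s t : ℝ, s < t → t < 0 → ∀ x, v t x =
        Literature.Analysis.UnboundedOperators.heatExtension (v s) (t - s) x -
          Literature.Analysis.FluidPDE.oseenDuhamel 1 s v v t x) →
      (∀ t < 0, Literature.Analysis.FluidPDE.VectorCalculus.IsDivFree (v t)) →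
      (∀ s < 0, ∀ y, ⟪Literature.Analysis.FluidPDE.curl (v s) y, EuclideanSpace.single 2 1⟫_ℝ = 0) →
      ∀ μ : ℝ → ℝ, (∀ s < 0, μ s < 0) → (∀ s < 0, AnalyticAt ℝ μ s) →
        (∃ s₁ s₂ : ℝ, s₁ < 0 ∧ s₂ < 0 ∧ μ s₁ ≠ μ s₂) →
        (∀ s < 0, ∀ y, ∀ b : Fin 3, b ≠ 2 →
          fderiv ℝ (v s) y (EuclideanSpace.single 2 1) b = μ s * fderiv ℝ (v s) y (EuclideanSpace.single b 1) 2) →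
        ¬ Literature.Analysis.FluidPDE.IsBackwardSingularPoint v 0 := by
  intro C v hrate hcont hmild hdiv hpol μ hneg han hnc hslope
  by_cases hB : ∃ M : ℝ, ∀ T : ℝ, ∃ τ < T, -M ≤ μ τ
  · exact Summit.NavierStokesRegularity.NavierStokesRegularity.Theorems.PoloidalWindowDoorPoloidalWindowRigidityTimeShearLiminf.stub_tvLiminf
      C v hrate hcont hmild hdiv hpol μ hneg han hnc hslope hB
  · push Not at hB
    refine nonflatLiouville_of_timeShear_unbounded hrate hcont hmild hdiv hpol hslope fun M => ?_
    obtain ⟨T, hT⟩ := hB M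
    refine ⟨T, fun τ hτ => ?_⟩
    have h1 : μ τ < -M := hT τ hτ
    have h2 : M < -μ τ := by linarith
    exact h2.le.trans (neg_le_abs (μ τ))

/-- **The slice-sharp residue from the stubs** (symmetry/genericity hypotheses unused): class + poloidal ⇒ not backward-singular,
by contradiction through `…K2OfLrcSpatial.nonflatLiouville_of_lrc_spatial`. -/
theorem sliceSharpNonflatLiouville_of_entireSlices :
    ∀ (C : ℝ) (v : ℝ → EuclideanSpace ℝ (Fin 3) → EuclideanSpace ℝ (Fin 3)),
      Literature.Analysis.FluidPDE.HasTypeITimeDecay C v →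
      ContinuousOn (Function.uncurry v) (Set.Iio (0 : ℝ) ×ˢ Set.univ) →
      (∀ s t : ℝ, s < t → t < 0 → ∀ x, v t x =
        Literature.Analysis.UnboundedOperators.heatExtension (v s) (t - s) x -
          Literature.Analysis.FluidPDE.oseenDuhamel 1 s v v t x) →
      (∀ t < 0, Literature.Analysis.FluidPDE.VectorCalculus.IsDivFree (v t)) →
      (∀ s < 0, ∀ y, ⟪Literature.Analysis.FluidPDE.curl (v s) y, EuclideanSpace.single 2 1⟫_ℝ = 0) →
      (∀ s < 0, ∀ y, ⟪fderiv ℝ (v s) y (Literature.Analysis.FluidPDE.curl (v s) y), EuclideanSpace.single 2 1⟫_ℝ = 0) →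
      (∀ s < 0, ∀ b : EuclideanSpace ℝ (Fin 3), b ≠ 0 → ∃ y,
        Literature.Analysis.FluidPDE.cross (Literature.Analysis.FluidPDE.curl (v s) y) b ≠ 0) →
      (∀ s < 0, ∃ y, fderiv ℝ (v s) y (EuclideanSpace.single 2 1) 0 ≠ 0 ∨
        fderiv ℝ (v s) y (EuclideanSpace.single 2 1) 1 ≠ 0) →
      (∀ s < 0, ∀ a : EuclideanSpace ℝ (Fin 3), a ≠ 0 → ⟪a, EuclideanSpace.single 2 1⟫_ℝ = 0 →
        ∃ y, ⟪fderiv ℝ (v s) y a, EuclideanSpace.single 2 1⟫_ℝ ≠ 0) →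
      (∀ s < 0, ∀ e : EuclideanSpace ℝ (Fin 3), e ≠ 0 → ∃ (y : EuclideanSpace ℝ (Fin 3)) (l : ℝ), v s (y + l • e) ≠ v s y) →
      (∀ s < 0, ∀ (L : EuclideanSpace ℝ (Fin 3) ≃ₗᵢ[ℝ] EuclideanSpace ℝ (Fin 3)) (c : EuclideanSpace ℝ (Fin 3)),
        ¬ Literature.Analysis.FluidPDE.IsAxisymmetric (fun y => L.symm (v s (L y + c)))) →
      (∃ lam : ℝ, 0 < lam ∧ ∃ s < 0, ∃ y, lam • v (lam ^ 2 * s) (lam • y) ≠ v s y) →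
        ¬ Literature.Analysis.FluidPDE.IsBackwardSingularPoint v 0 := by
  intro C v hrate hcont hmild hdiv hpol _ _ _ _ _ _ _ hsing
  exact nonflatLiouville_of_lrc_spatial hrate hcont hmild hdiv hpol
    (lrcSpatial_of_stubs C v hrate hcont hmild hdiv hpol hsing) (tv_of_stubs C v hrate hcont hmild hdiv hpol) hsing

/-- **COMPOSITION (proved): the crux `PoloidalWindowRigidity` BY NAME from the three stubs `stub_horizontalEntire`,
`stub_entireTH`, `stub_entireThick`**, via the landed reduction `…Sharper.poloidalWindowRigidity_of_sliceSharpNonflatLiouville`. -/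
theorem PoloidalWindowRigidity_of_entireSlices :
    Summit.NavierStokesRegularity.NavierStokesRegularity.Theses.PoloidalWindowDoor.PoloidalWindowRigidity :=
  poloidalWindowRigidity_of_sliceSharpNonflatLiouville sliceSharpNonflatLiouville_of_entireSlices

end Summit.NavierStokesRegularity.NavierStokesRegularity.Cruxes.PoloidalWindowRigidity.EntireSlices
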